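import Mathlib
import Summits.MatrixMultiplication.MatrixMultiplication.Theorems.SnSubsetDichotomyPolynomialSlackScatteredMatching
import Summits.MatrixMultiplication.MatrixMultiplication.Theorems.SnSubsetDichotomyPolynomialSlackMatchingCells

/-!
# Two dense quotients: the matching branch is impossible

Crux `Summit.MatrixMultiplication.MatrixMultiplication.Theses.SnSubsetDichotomy.PolynomialSlack`
(item `stmt-MatrixMultiplication-8306`), level-one programme, lead c8 (two dense quotients: the matching
branch is impossible), line transport-split-hull, registered stub `twoDense_matching_absurd`.

Let `S, T, U ⊆ S_n` (`n ≥ 1`) have the triple product property with both quotient sets DENSE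
(`n!/|S||T|, n!/|T||U| < 16 M`), quotient profiles `dA`, `dB`, and let `pC ≥ 0` be the heavy part of the
sparse quotient profile: total mass `≥ 3/4`, every row and column mass `≤ τ` with
`τ · 140000 (1 + log n) log(96 M) ≤ 1`, and small collision weight
`Σ_{k,i} pC(k,i) · (n Σ_j dA(i,j) dB(j,k)) ≤ 1/512`.  This is absurd:

* `exists_scattered_matching` (with `ε = 1/128`) yields a matching `Mt` of scattered cells
  (`n Σ_j dA(i,j) dB(j,k) ≤ 1/128`) with `|Mt| ≥ 1/(4τ) ≥ 35000 (1 + log n) log(96 M)`;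
* `matchingCells_card_le` bounds `|Mt| ≤ 33430 (1 + log n) log(96 M)`;
* `(1 + log n) log(96 M) ≥ log 96 > 0`.
-/

namespace Summit.MatrixMultiplication.MatrixMultiplication.Theorems.PolynomialSlack

set_option linter.dupNamespace false

open scoped BigOperators
open Literature.Combinatorics.Additive (TripleProductProperty)

/-- **Two dense quotients, matching branch.** With both quotient sets dense (`n!/|S||T|, n!/|T||U| < 16M`),
a nonnegative heavy profile `pC` of total mass `≥ 3/4`, row and column masses `≤ τ` where
`τ · 140000 (1 + log n) log(96 M) ≤ 1`, and collision weight `Σ pC · (n Σ_j dA dB) ≤ 1/512` cannot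
exist: a scattered matching would have at least `1/(4τ)` and at most `33430 (1 + log n) log(96 M)`
cells. [folklore] -/
theorem twoDense_matching_absurd {n : ℕ} (hn : 1 ≤ n) {S T U : Finset (Equiv.Perm (Fin n))}
    (hTPP : TripleProductProperty S T U) (hS0 : S.Nonempty) (hT0 : T.Nonempty) (hU0 : U.Nonempty)
    (dA dB pC : Fin n → Fin n → ℝ)
    (hdA : ∀ i j, dA i j = (((S ×ˢ T).filter fun st => st.2 j = st.1 i).card : ℝ) / (S.card * T.card : ℕ))
    (hdB : ∀ j k, dB j k = (((T ×ˢ U).filter fun tu => tu.2 k = tu.1 j).card : ℝ) / (T.card * U.card : ℕ))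
    (hp0 : ∀ k i, 0 ≤ pC k i)
    (M τ : ℝ) (hM : 1 ≤ M) (hτ : 0 < τ)
    (hτM : τ * (140000 * (1 + Real.log n) * Real.log (96 * M)) ≤ 1)
    (hKA : (n.factorial : ℝ) / (S.card * T.card : ℕ) < 16 * M)
    (hKB : (n.factorial : ℝ) / (T.card * U.card : ℕ) < 16 * M)
    (hrow : ∀ k, ∑ i : Fin n, pC k i ≤ τ) (hcol : ∀ i, ∑ k : Fin n, pC k i ≤ τ)
    (hW : 3 / 4 ≤ ∑ k : Fin n, ∑ i : Fin n, pC k i)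
    (hΦ : ∑ k : Fin n, ∑ i : Fin n, pC k i * ((n : ℝ) * ∑ j : Fin n, dA i j * dB j k) ≤ 1 / 512) :
    False := by
  -- nonnegativity of the two profiles and of the collision weight
  have hdA0 : ∀ i j, 0 ≤ dA i j := fun i j => by rw [hdA]; positivity
  have hdB0 : ∀ j k, 0 ≤ dB j k := fun j k => by rw [hdB]; positivity
  have hc0 : ∀ k i, 0 ≤ (n : ℝ) * ∑ j : Fin n, dA i j * dB j k := fun k i =>
    mul_nonneg (Nat.cast_nonneg n) (Finset.sum_nonneg fun j _ => mul_nonneg (hdA0 i j) (hdB0 j k))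
  -- STEP 1: a matching of scattered cells with at least `1/(4τ)` elements
  have hε : (0 : ℝ) < 1 / 128 := by norm_num
  have hΦ' : ∑ k : Fin n, ∑ i : Fin n, pC k i * ((n : ℝ) * ∑ j : Fin n, dA i j * dB j k) ≤
      1 / 128 / 4 := hΦ.trans (by norm_num)
  obtain ⟨Mt, h1, h2, hcell, hcard⟩ := exists_scattered_matching pC
    (fun k i => (n : ℝ) * ∑ j : Fin n, dA i j * dB j k) τ (1 / 128) hτ hε hp0 hc0 hrow hcol hW hΦ'
  -- STEP 2: a matching of scattered cells has at most `33430 (1 + log n) log (96 M)` elements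
  have hle : (Mt.card : ℝ) ≤ 33430 * (1 + Real.log n) * Real.log (96 * M) :=
    matchingCells_card_le hn hTPP hS0 hT0 hU0 dA dB hdA hdB M hM hKA hKB Mt h1 h2
      (fun e he => (hcell e he).2)
  -- STEP 3: the two bounds are incompatible since `τ · 140000 (1 + log n) log (96 M) ≤ 1`
  have hlogn : 0 ≤ Real.log n := Real.log_nonneg (by exact_mod_cast hn)
  have hlogM : 0 < Real.log (96 * M) := Real.log_pos (by linarith)
  have hL : 0 < (1 + Real.log n) * Real.log (96 * M) := mul_pos (by linarith) hlogM
  have hA : 1 / (4 * τ) ≤ 33430 * (1 + Real.log n) * Real.log (96 * M) := hcard.trans hle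
  rw [div_le_iff₀ (by positivity : (0 : ℝ) < 4 * τ)] at hA
  nlinarith [mul_pos hτ hL]

end Summit.MatrixMultiplication.MatrixMultiplication.Theorems.PolynomialSlack
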